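import Summits.BirchSwinnertonDyer.BirchSwinnertonDyer.Theorems.AlignedTransportAtTwoMainConjectureOfRankZeroBSDAtTwoResolventMuUnconditional
import Literature.NumberTheory.IwasawaTheory.SymmetricThreeTowerExact
import HarnessLib

/-!
# Route `AlignedTransportAtTwo`, crux C2 `MainConjectureOfRankZeroBSDAtTwo` (stmt-BirchSwinnertonDyer-22298):
# THE EXACT `S₃` CLASS-NUMBER RELATION AT `p = 2` ON THE SEXTIC CARRIER — `ord₂ h(ℚ(W[2])) = ord₂ h(ℚ(√Δ_W)) + 2·ord₂ h(ℚ(β))`,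
# and `e_n(ℚ(W[2])) = e_n(ℚ(√Δ_W)) + 2·e_n(ℚ(β))` AT EVERY LAYER of the cyclotomic `ℤ₂`-towers, BOTH signs of `Δ_W`, NO `μ`-hypothesis

HONEST FRAMING. WIDTH-5 attached prover seat `bsd-line-att-p4` g30 on line `birth` of the lead `bsd-line-att-p2`; `--supports`
stmt-BirchSwinnertonDyer-22298, closes nothing; BSD is NOT proved; crux C2, its verdict «blocked-on `Rank1Residual.GreenbergMuConjectureIrreducible`»
and every registered stub untouched. THEOREMS ONLY (no `def`, no named fact, no `sorry`).

WHAT. The `S₃` ledger of C2 (att-p4 g28/g29 `…SexticNormRelationDescent*`, att-p3 g33/g34 `…SexticLambdaKuroda`, `…ResolventMuUnconditional`) had the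
Brauer–Kuroda relation between `T = ℚ(W[2])`, the resolvent `ℚ(√Δ_W)` and the cubic point field `ℚ(β)` only as an INEQUALITY
`e_n(T) ≤ Σ_j e_n(ℚ(β_j)) + e_n(ℚ(√Δ_W))` ([BiasseEtAl2022] Prop. 3.7), as an equality only on the rows where the cubic towers are `2`-free, and the
`λ`-identity only under `μ = 0` inputs. This file instantiates this seat's kernel proof of the EXACT `2`-part of the `S₃` class number relation
(`Literature.NumberTheory.NumberFields.KurodaRelationSymmetricThreeExact`, after [Walter1979Brauer], [CaputoNuccio2020] Prop. 3.12, [Bartel2012] Cor. 5.2: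
`ord₂ h(L) + 2·ord₂ h(L^{⟨σ,τ⟩}) = ord₂ h(L^{⟨σ⟩}) + 2·ord₂ h(L^{⟨τ⟩})`, proved from the ambiguous-class/Herbrand-quotient calculus — no character
theory, no regulators) and of its tower form (`Literature.NumberTheory.IwasawaTheory.SymmetricThreeTowerExact`) on the sextic carrier:
* §1 ★★ `padicValNat_two_classNumber_divisionField_two` — for EVERY elliptic `W/ℚ` with no rational `2`-torsion abscissa and `Δ_W ∉ ℚ²` (both signs,
  nothing else): **`ord₂ h(ℚ(W[2])) = ord₂ h(ℚ(4δ₀)) + 2·ord₂ h(ℚ(β_j))`** (`(4δ₀)² = Δ_W`, `β_j` any root of the `2`-division cubic, models in `ℚ̄`);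
  `odd_classNumber_divisionField_two_iff` — `h(ℚ(W[2]))` odd ⟺ `h(ℚ(√Δ_W))` and `h(ℚ(β_j))` both odd.
* §2 ★★ `classNumberPExp_divisionField_two_eq_resolvent_add_two_mul_cubic` — with also `2Δ_W ∉ ℚ²` (automatic on C2's binders) and ANY cyclotomic
  `ℤ₂`-extensions `κ_T, κ_K, κ_k` of `T`, `ℚ(4δ₀)`, `ℚ(β_j)`: **`e_n(T) = e_n(ℚ(√Δ_W)) + 2·e_n(ℚ(β_j))` for every `n`** (`e_n = ord₂ h(n-th layer)`) —
  g29's inequality is an identity, at every layer, unconditionally; `…_of_isOrdinaryAt` on C2's own binders.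
* §3 corollaries: `classNumberPExp_divisionField_two_eq_resolvent_iff_cubic` (`e_n(T) = e_n(ℚ(√Δ_W)) ⟺ e_n(ℚ(β_j)) = 0`, layer by layer — g29's
  ★★ needed `2`-freeness of all cubic towers at all layers), `classNumberPExp_resolvent_le_divisionField_two`, `classNumberPExp_cubic_eq_cubic`
  (`e_n(ℚ(β_i)) = e_n(ℚ(β_j))`).
What this does NOT do: no value of any `λ₂` or `μ₂` is computed; the `λ`-identity stays att-p3 g34's (it needs `μ₂(ℚ(β)) = 0`, which for `Δ_W > 0` is
Greenberg's conjecture); PFμ⁺ / Kμ / the crux are untouched. BSD is not proved by any of this.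
References: [Walter1979Brauer]; [CaputoNuccio2020] Prop. 3.12, Rem. 3.13; [Bartel2012] Cor. 5.2; [Washington1997] §13.1, §13.3; [NeukirchANT1999] I §6;
tree: this seat's `DihedralUnitIdentities`, `DihedralUnitCohomologyComparison`, `DihedralRamifiedPrimesComparison`, `SymmetricThreeFixedClassesDescent`,
`KurodaRelationSymmetricThreeExact`, `SymmetricThreeTowerExact`; att-p4 g28/g29 and att-p3 g33/g34 files named above.
-/

set_option linter.dupNamespace false
set_option autoImplicit false

noncomputable section

open scoped Classical NumberField

namespace Summit.BirchSwinnertonDyer.BirchSwinnertonDyer.Theorems.AlignedTransportAtTwoSexticKurodaExact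

open NumberField Polynomial WeierstrassCurve IntermediateField Field
  Literature.NumberTheory.EllipticCurves Literature.NumberTheory.EllipticCurves.Greenberg1999
  Literature.NumberTheory.EllipticCurves.DokchitserDokchitser2012
  Literature.NumberTheory.EllipticCurves.ZpExtension Literature.NumberTheory.GaloisRepresentations
  Literature.NumberTheory.IwasawaTheory Literature.NumberTheory.NumberFields
  Literature.NumberTheory.NumberFields.KurodaSymmetricThree
  Summit.BirchSwinnertonDyer.BirchSwinnertonDyer.Theorems.AlignedTransportAtTwoFineRoad.DivisionCubic
  Summit.BirchSwinnertonDyer.BirchSwinnertonDyer.Theorems.AlignedTransportAtTwoFineRoad.TowerImageDelta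
  Summit.BirchSwinnertonDyer.BirchSwinnertonDyer.Theorems.AlignedTransportAtTwoCubicClosureParity
  Summit.BirchSwinnertonDyer.BirchSwinnertonDyer.Theorems.AlignedTransportAtTwoSexticTowerGrowth
  Summit.BirchSwinnertonDyer.BirchSwinnertonDyer.Theorems.AlignedTransportAtTwoSexticNormRelationDescent
  Summit.BirchSwinnertonDyer.BirchSwinnertonDyer.Theorems.AlignedTransportAtTwoSexticNormRelationDescentMu
  Summit.BirchSwinnertonDyer.BirchSwinnertonDyer.Theorems.AlignedTransportAtTwoSexticNormRelationDescentSignFree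
  Summit.BirchSwinnertonDyer.BirchSwinnertonDyer.Theorems.AlignedTransportAtTwoResolventMuUnconditional

variable (W : WeierstrassCurve ℚ) [W.IsElliptic]

/-! ## §1 The bottom fields: `ord₂ h(ℚ(W[2])) = ord₂ h(ℚ(√Δ_W)) + 2·ord₂ h(ℚ(β))` -/

/-- ★★ **`ord₂ h(ℚ(W[2])) = ord₂ h(ℚ(4δ₀)) + 2·ord₂ h(ℚ(β_j))`** for every elliptic `W/ℚ` with no rational `2`-torsion abscissa and `Δ_W ∉ ℚ²`
(`T = ℚ(W[2])` is then an `S₃`-sextic; `(4δ₀)² = Δ_W`; `β_j` a root of the `2`-division cubic; BOTH signs of `Δ_W`): the exact `2`-part of the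
Brauer–Kuroda class number relation for `S₃` (Walter; Caputo–Nuccio; Bartel), this seat's kernel theorem `padicValNat_two_classNumber_symmetricThree`
on the sign-free `S₃`-pair of `Gal(T/ℚ)` (att-p3 g34), the fixed fields identified with their models in `ℚ̄` (att-p4 g28) and `h(ℚ) = 1`.
[cite: CaputoNuccio2020, Prop. 3.12] [cite: Bartel2012, Cor. 5.2] [cite: Walter1979Brauer, Thm.] -/
theorem padicValNat_two_classNumber_divisionField_two (ht : ∀ x : ℚ, ¬ HasRationalTwoTorsionX W x) (hsq : ¬ IsSquare W.Δ) (j : Fin 3) :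
    haveI : FiniteDimensional ℚ ↥ℚ⟮xT W two_ne_zero j⟯ :=
      IntermediateField.adjoin.finiteDimensional ((AlgebraicClosure.isAlgebraic ℚ).isAlgebraic _).isIntegral
    haveI : NumberField ↥ℚ⟮xT W two_ne_zero j⟯ := NumberField.mk
    haveI : FiniteDimensional ℚ ↥ℚ⟮4 * delta W two_ne_zero⟯ :=
      IntermediateField.adjoin.finiteDimensional ((AlgebraicClosure.isAlgebraic ℚ).isAlgebraic _).isIntegral
    haveI : NumberField ↥ℚ⟮4 * delta W two_ne_zero⟯ := NumberField.mk
    haveI : NumberField (W.divisionField 2) := NumberField.mk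
    padicValNat 2 (classNumber (W.divisionField 2)) =
      padicValNat 2 (classNumber ↥ℚ⟮4 * delta W two_ne_zero⟯) + 2 * padicValNat 2 (classNumber ↥ℚ⟮xT W two_ne_zero j⟯) := by
  haveI : NumberField (W.divisionField 2) := NumberField.mk
  haveI : IsGalois ℚ (W.divisionField 2) := W.isGalois_divisionField 2
  haveI : FiniteDimensional ℚ ↥ℚ⟮xT W two_ne_zero j⟯ :=
    IntermediateField.adjoin.finiteDimensional ((AlgebraicClosure.isAlgebraic ℚ).isAlgebraic _).isIntegral
  haveI : NumberField ↥ℚ⟮xT W two_ne_zero j⟯ := NumberField.mk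
  haveI : FiniteDimensional ℚ ↥ℚ⟮4 * delta W two_ne_zero⟯ :=
    IntermediateField.adjoin.finiteDimensional ((AlgebraicClosure.isAlgebraic ℚ).isAlgebraic _).isIntegral
  haveI : NumberField ↥ℚ⟮4 * delta W two_ne_zero⟯ := NumberField.mk
  haveI : ∀ E : IntermediateField ℚ (W.divisionField 2), NumberField ↥E := fun E ↦ NumberField.mk
  obtain ⟨σ, τ, hσC, hτH, hσ3, hτ2, hτσ, hgen⟩ := exists_symmetricThree_gal_of_not_isSquare W ht hsq j
  -- models of the three fixed fields
  obtain ⟨φK₀⟩ := nonempty_algEquiv_fixedField_resolvent W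
  obtain ⟨φk₀⟩ := nonempty_algEquiv_fixedField_cubic W j
  obtain ⟨φ₀⟩ := nonempty_algEquiv_fixedField_top W
  have φK : ↥(fixedField (Subgroup.zpowers σ)) ≃ₐ[ℚ] ↥ℚ⟮4 * delta W two_ne_zero⟯ :=
    (IntermediateField.equivOfEq (by rw [hσC])).trans φK₀
  have φk : ↥(fixedField (Subgroup.zpowers τ)) ≃ₐ[ℚ] ↥ℚ⟮xT W two_ne_zero j⟯ :=
    (IntermediateField.equivOfEq (by rw [hτH])).trans φk₀
  have φ : ↥(fixedField (Subgroup.closure ({σ, τ} : Set (W.divisionField 2 ≃ₐ[ℚ] W.divisionField 2)))) ≃ₐ[ℚ] ℚ :=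
    (IntermediateField.equivOfEq (by rw [hgen])).trans φ₀
  have main := padicValNat_two_classNumber_symmetricThree ℚ (W.divisionField 2) σ τ hσ3 hτ2 hτσ
  rw [classNumber_eq_of_ringEquiv_aux φ.toRingEquiv, Rat.classNumber_eq, padicValNat_one_right, mul_zero, add_zero,
    classNumber_eq_of_ringEquiv_aux φK.toRingEquiv, classNumber_eq_of_ringEquiv_aux φk.toRingEquiv] at main
  exact main

/-- `ord₂ m = 0 ⟺ m odd` for `m ≠ 0`. [folklore] -/
private theorem padicValNat_two_eq_zero_iff_odd {m : ℕ} (hm : m ≠ 0) : padicValNat 2 m = 0 ↔ Odd m := by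
  rw [padicValNat.eq_zero_iff, Nat.odd_iff]
  omega

/-- ★ **`h(ℚ(W[2]))` is odd iff `h(ℚ(√Δ_W))` and `h(ℚ(β_j))` are both odd** (every elliptic `W/ℚ` with no rational `2`-torsion abscissa and
`Δ_W ∉ ℚ²`, both signs) — the parity row of the exact relation. [cite: CaputoNuccio2020, Prop. 3.12] [cite: Walter1979Brauer, Thm.] -/
theorem odd_classNumber_divisionField_two_iff (ht : ∀ x : ℚ, ¬ HasRationalTwoTorsionX W x) (hsq : ¬ IsSquare W.Δ) (j : Fin 3) :
    haveI : FiniteDimensional ℚ ↥ℚ⟮xT W two_ne_zero j⟯ :=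
      IntermediateField.adjoin.finiteDimensional ((AlgebraicClosure.isAlgebraic ℚ).isAlgebraic _).isIntegral
    haveI : NumberField ↥ℚ⟮xT W two_ne_zero j⟯ := NumberField.mk
    haveI : FiniteDimensional ℚ ↥ℚ⟮4 * delta W two_ne_zero⟯ :=
      IntermediateField.adjoin.finiteDimensional ((AlgebraicClosure.isAlgebraic ℚ).isAlgebraic _).isIntegral
    haveI : NumberField ↥ℚ⟮4 * delta W two_ne_zero⟯ := NumberField.mk
    haveI : NumberField (W.divisionField 2) := NumberField.mk
    Odd (classNumber (W.divisionField 2)) ↔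
      Odd (classNumber ↥ℚ⟮4 * delta W two_ne_zero⟯) ∧ Odd (classNumber ↥ℚ⟮xT W two_ne_zero j⟯) := by
  haveI : NumberField (W.divisionField 2) := NumberField.mk
  haveI : FiniteDimensional ℚ ↥ℚ⟮xT W two_ne_zero j⟯ :=
    IntermediateField.adjoin.finiteDimensional ((AlgebraicClosure.isAlgebraic ℚ).isAlgebraic _).isIntegral
  haveI : NumberField ↥ℚ⟮xT W two_ne_zero j⟯ := NumberField.mk
  haveI : FiniteDimensional ℚ ↥ℚ⟮4 * delta W two_ne_zero⟯ :=
    IntermediateField.adjoin.finiteDimensional ((AlgebraicClosure.isAlgebraic ℚ).isAlgebraic _).isIntegral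
  haveI : NumberField ↥ℚ⟮4 * delta W two_ne_zero⟯ := NumberField.mk
  have h0 : ∀ (M : Type) [Field M] [NumberField M], NumberField.classNumber M ≠ 0 := by
    intro M _ _
    unfold NumberField.classNumber
    exact Fintype.card_ne_zero
  have h := padicValNat_two_classNumber_divisionField_two W ht hsq j
  rw [← padicValNat_two_eq_zero_iff_odd (h0 (W.divisionField 2)), ← padicValNat_two_eq_zero_iff_odd (h0 ↥ℚ⟮4 * delta W two_ne_zero⟯),
    ← padicValNat_two_eq_zero_iff_odd (h0 ↥ℚ⟮xT W two_ne_zero j⟯)]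
  omega

/-! ## §2 Every layer: `e_n(ℚ(W[2])) = e_n(ℚ(√Δ_W)) + 2·e_n(ℚ(β))` -/

/-- ★★ **THE EXACT `S₃` RELATION AT EVERY LAYER, BOTH SIGNS OF `Δ_W`.** `W/ℚ` elliptic, no rational `2`-torsion abscissa, `Δ_W ∉ ℚ²`, `2Δ_W ∉ ℚ²`;
`κ_T, κ_K, κ_k` ANY cyclotomic `ℤ₂`-extensions of `T = ℚ(W[2])`, of the resolvent model `ℚ(4δ₀) ⊆ ℚ̄` (`(4δ₀)² = Δ_W`) and of the cubic model
`ℚ(β_j) ⊆ ℚ̄`. Then for every `n`: **`e_n(T) = e_n(ℚ(4δ₀)) + 2·e_n(ℚ(β_j))`** — this seat's tower theorem `classNumberPExp_symmetricThree_exact`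
(the exact relation for the `S₃`-extensions `T·ℚ_n/ℚ_n`) on the sign-free `S₃`-pair, `T ∩ ℚ_∞ = ℚ` (att-p4 g29), the models (g28), `e_n(ℚ) = 0`
(Weber–Iwasawa, tree) and independence of the normalisation. No `μ`, `2`-freeness or parity hypothesis.
[cite: CaputoNuccio2020, Prop. 3.12] [cite: Bartel2012, Cor. 5.2] [cite: Washington1997, §13.1 and Prop. 13.22] -/
theorem classNumberPExp_divisionField_two_eq_resolvent_add_two_mul_cubic (ht : ∀ x : ℚ, ¬ HasRationalTwoTorsionX W x) (hsq : ¬ IsSquare W.Δ)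
    (h2Δ : ¬ IsSquare (2 * W.Δ)) (j : Fin 3) (κT : ZpExtension (W.divisionField 2) 2) (hκT : κT.IsCyclotomic)
    (κK : ZpExtension ↥ℚ⟮4 * delta W two_ne_zero⟯ 2) (hκK : κK.IsCyclotomic)
    (κk : ZpExtension ↥ℚ⟮xT W two_ne_zero j⟯ 2) (hκk : κk.IsCyclotomic) (n : ℕ) :
    classNumberPExp κT n = classNumberPExp κK n + 2 * classNumberPExp κk n := by
  haveI : NumberField (W.divisionField 2) := NumberField.mk
  haveI : IsGalois ℚ (W.divisionField 2) := W.isGalois_divisionField 2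
  haveI : ∀ i : Fin 3, FiniteDimensional ℚ ↥ℚ⟮xT W two_ne_zero i⟯ := fun i ↦
    IntermediateField.adjoin.finiteDimensional ((AlgebraicClosure.isAlgebraic ℚ).isAlgebraic _).isIntegral
  haveI : ∀ i : Fin 3, NumberField ↥ℚ⟮xT W two_ne_zero i⟯ := fun i ↦ NumberField.mk
  haveI : FiniteDimensional ℚ ↥ℚ⟮4 * delta W two_ne_zero⟯ :=
    IntermediateField.adjoin.finiteDimensional ((AlgebraicClosure.isAlgebraic ℚ).isAlgebraic _).isIntegral
  haveI : NumberField ↥ℚ⟮4 * delta W two_ne_zero⟯ := NumberField.mk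
  obtain ⟨κ, hκ⟩ := exists_cyclotomicZpExtension_holds ℚ 2
  have hL := surjective_gal_restrict_of_not_isSquare W ht hsq h2Δ κ hκ
  obtain ⟨σ, τ, hσC, hτH, hσ3, hτ2, hτσ, hgen⟩ := exists_symmetricThree_gal_of_not_isSquare W ht hsq j
  haveI : ∀ E : IntermediateField ℚ (W.divisionField 2), NumberField ↥E := fun E ↦ NumberField.mk
  have hR := surjective_comp_absGaloisRestrict_of_tower κ ↥(fixedField (Subgroup.zpowers σ)) (W.divisionField 2) hL
  have hK := surjective_comp_absGaloisRestrict_of_tower κ ↥(fixedField (Subgroup.zpowers τ)) (W.divisionField 2) hL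
  have hk := surjective_comp_absGaloisRestrict_of_tower κ
    ↥(fixedField (Subgroup.closure ({σ, τ} : Set (W.divisionField 2 ≃ₐ[ℚ] W.divisionField 2)))) (W.divisionField 2) hL
  have hR' := surjective_resolvent_restrict_of_not_isSquare W hsq h2Δ κ hκ
  have hK' : Function.Surjective (κ.toContinuousMonoidHom.comp (absGaloisRestrict ℚ ↥ℚ⟮xT W two_ne_zero j⟯)) :=
    surjective_cubic_restrict W ht κ j
  have hk' : Function.Surjective (κ.toContinuousMonoidHom.comp (absGaloisRestrict ℚ ℚ)) :=
    surjective_comp_absGaloisRestrict_of_not_dvd_finrank κ ℚ (by rw [Module.finrank_self]; decide)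
  -- models of the three fixed fields
  obtain ⟨φK₀⟩ := nonempty_algEquiv_fixedField_resolvent W
  obtain ⟨φk₀⟩ := nonempty_algEquiv_fixedField_cubic W j
  obtain ⟨φ₀⟩ := nonempty_algEquiv_fixedField_top W
  have φK : ↥(fixedField (Subgroup.zpowers σ)) ≃ₐ[ℚ] ↥ℚ⟮4 * delta W two_ne_zero⟯ :=
    (IntermediateField.equivOfEq (by rw [hσC])).trans φK₀
  have φk : ↥(fixedField (Subgroup.zpowers τ)) ≃ₐ[ℚ] ↥ℚ⟮xT W two_ne_zero j⟯ :=
    (IntermediateField.equivOfEq (by rw [hτH])).trans φk₀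
  have φ : ↥(fixedField (Subgroup.closure ({σ, τ} : Set (W.divisionField 2 ≃ₐ[ℚ] W.divisionField 2)))) ≃ₐ[ℚ] ℚ :=
    (IntermediateField.equivOfEq (by rw [hgen])).trans φ₀
  -- the exact relation along `κ` (restated in this context), then transport to the given towers
  have main : classNumberPExp (κ.restrict (W.divisionField 2) hL) n +
      2 * classNumberPExp (κ.restrict ↥(fixedField (Subgroup.closure ({σ, τ} : Set (W.divisionField 2 ≃ₐ[ℚ] W.divisionField 2)))) hk) n =
      classNumberPExp (κ.restrict ↥(fixedField (Subgroup.zpowers σ)) hR) n +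
        2 * classNumberPExp (κ.restrict ↥(fixedField (Subgroup.zpowers τ)) hK) n :=
    classNumberPExp_symmetricThree_exact κ (W.divisionField 2) hL hσ3 hτ2 hτσ hR hK hk n
  have e0 : classNumberPExp (κ.restrict ↥(fixedField (Subgroup.closure ({σ, τ} : Set (W.divisionField 2 ≃ₐ[ℚ] W.divisionField 2)))) hk) n = 0 := by
    rw [classNumberPExp_restrict_eq_of_algEquiv κ φ hk hk' n]
    exact classNumberPExp_rat_eq_zero _ n
  have eT : classNumberPExp κT n = classNumberPExp (κ.restrict (W.divisionField 2) hL) n :=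
    classNumberPExp_eq_of_isCyclotomic κT _ hκT (isCyclotomic_restrict κ hκ _ hL) n
  have eK : classNumberPExp κK n = classNumberPExp (κ.restrict ↥(fixedField (Subgroup.zpowers σ)) hR) n := by
    rw [classNumberPExp_restrict_eq_of_algEquiv κ φK hR hR' n]
    exact classNumberPExp_eq_of_isCyclotomic κK _ hκK (isCyclotomic_restrict κ hκ _ hR') n
  have ek : classNumberPExp κk n = classNumberPExp (κ.restrict ↥(fixedField (Subgroup.zpowers τ)) hK) n := by
    rw [classNumberPExp_restrict_eq_of_algEquiv κ φk hK hK' n]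
    exact classNumberPExp_eq_of_isCyclotomic κk _ hκk (isCyclotomic_restrict κ hκ _ hK') n
  omega

/-- ★ **The exact relation on the crux's own binders** (`W` globally minimal, good ordinary at `2`, no rational `2`-torsion abscissa, `Δ_W ∉ ℚ²`; BOTH
signs; `2Δ_W ∉ ℚ²` is automatic, att-p4 g29): `e_n(ℚ(W[2])) = e_n(ℚ(√Δ_W)) + 2·e_n(ℚ(β_j))` for every `n` and any cyclotomic towers.
[cite: CaputoNuccio2020, Prop. 3.12] [cite: Washington1997, §13.1] -/
theorem classNumberPExp_divisionField_two_eq_resolvent_add_two_mul_cubic_of_isOrdinaryAt [W.IsGloballyMinimal] (hord : IsOrdinaryAt W 2)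
    (ht : ∀ x : ℚ, ¬ HasRationalTwoTorsionX W x) (hsq : ¬ IsSquare W.Δ) (j : Fin 3)
    (κT : ZpExtension (W.divisionField 2) 2) (hκT : κT.IsCyclotomic)
    (κK : ZpExtension ↥ℚ⟮4 * delta W two_ne_zero⟯ 2) (hκK : κK.IsCyclotomic)
    (κk : ZpExtension ↥ℚ⟮xT W two_ne_zero j⟯ 2) (hκk : κk.IsCyclotomic) (n : ℕ) :
    classNumberPExp κT n = classNumberPExp κK n + 2 * classNumberPExp κk n :=
  classNumberPExp_divisionField_two_eq_resolvent_add_two_mul_cubic W ht hsq (not_isSquare_two_mul_Δ_of_isOrdinaryAt W hord) j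
    κT hκT κK hκK κk hκk n

/-! ## §3 Corollaries -/

/-- **`e_n(ℚ(W[2])) = e_n(ℚ(√Δ_W)) ⟺ e_n(ℚ(β_j)) = 0`, layer by layer** (both signs of `Δ_W`): the sextic tower has the resolvent's `2`-class number at
layer `n` exactly when the cubic tower is `2`-free at layer `n` (g29's `…_eq_resolvent_of_cubic` had only `⟸`, and only from `2`-freeness of ALL cubic
towers at ALL layers). [cite: CaputoNuccio2020, Prop. 3.12] -/
theorem classNumberPExp_divisionField_two_eq_resolvent_iff_cubic (ht : ∀ x : ℚ, ¬ HasRationalTwoTorsionX W x) (hsq : ¬ IsSquare W.Δ)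
    (h2Δ : ¬ IsSquare (2 * W.Δ)) (j : Fin 3) (κT : ZpExtension (W.divisionField 2) 2) (hκT : κT.IsCyclotomic)
    (κK : ZpExtension ↥ℚ⟮4 * delta W two_ne_zero⟯ 2) (hκK : κK.IsCyclotomic)
    (κk : ZpExtension ↥ℚ⟮xT W two_ne_zero j⟯ 2) (hκk : κk.IsCyclotomic) (n : ℕ) :
    classNumberPExp κT n = classNumberPExp κK n ↔ classNumberPExp κk n = 0 := by
  rw [classNumberPExp_divisionField_two_eq_resolvent_add_two_mul_cubic W ht hsq h2Δ j κT hκT κK hκK κk hκk n]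
  omega

/-- **`e_n(ℚ(√Δ_W)) ≤ e_n(ℚ(W[2]))` and `2·e_n(ℚ(β_j)) ≤ e_n(ℚ(W[2]))` at every layer** (both signs). [cite: CaputoNuccio2020, Prop. 3.12] -/
theorem classNumberPExp_resolvent_le_divisionField_two (ht : ∀ x : ℚ, ¬ HasRationalTwoTorsionX W x) (hsq : ¬ IsSquare W.Δ)
    (h2Δ : ¬ IsSquare (2 * W.Δ)) (j : Fin 3) (κT : ZpExtension (W.divisionField 2) 2) (hκT : κT.IsCyclotomic)
    (κK : ZpExtension ↥ℚ⟮4 * delta W two_ne_zero⟯ 2) (hκK : κK.IsCyclotomic)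
    (κk : ZpExtension ↥ℚ⟮xT W two_ne_zero j⟯ 2) (hκk : κk.IsCyclotomic) (n : ℕ) :
    classNumberPExp κK n ≤ classNumberPExp κT n ∧ 2 * classNumberPExp κk n ≤ classNumberPExp κT n := by
  rw [classNumberPExp_divisionField_two_eq_resolvent_add_two_mul_cubic W ht hsq h2Δ j κT hκT κK hκK κk hκk n]
  omega

/-- **`e_n(ℚ(β_i)) = e_n(ℚ(β_j))`** for the cyclotomic `ℤ₂`-towers of any two of the (conjugate) cubic point fields, at every layer — read off the exact
relation (both determine `(e_n(T) − e_n(ℚ(√Δ_W)))/2`). [cite: CaputoNuccio2020, Prop. 3.12] -/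
theorem classNumberPExp_cubic_eq_cubic (ht : ∀ x : ℚ, ¬ HasRationalTwoTorsionX W x) (hsq : ¬ IsSquare W.Δ) (h2Δ : ¬ IsSquare (2 * W.Δ))
    (i j : Fin 3) (κi : ZpExtension ↥ℚ⟮xT W two_ne_zero i⟯ 2) (hκi : κi.IsCyclotomic)
    (κj : ZpExtension ↥ℚ⟮xT W two_ne_zero j⟯ 2) (hκj : κj.IsCyclotomic) (n : ℕ) :
    classNumberPExp κi n = classNumberPExp κj n := by
  haveI : NumberField (W.divisionField 2) := NumberField.mk
  haveI : FiniteDimensional ℚ ↥ℚ⟮4 * delta W two_ne_zero⟯ :=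
    IntermediateField.adjoin.finiteDimensional ((AlgebraicClosure.isAlgebraic ℚ).isAlgebraic _).isIntegral
  haveI : NumberField ↥ℚ⟮4 * delta W two_ne_zero⟯ := NumberField.mk
  obtain ⟨κT, hκT⟩ := exists_cyclotomicZpExtension_holds (W.divisionField 2) 2
  obtain ⟨κK, hκK⟩ := exists_cyclotomicZpExtension_holds ↥ℚ⟮4 * delta W two_ne_zero⟯ 2
  have hi := classNumberPExp_divisionField_two_eq_resolvent_add_two_mul_cubic W ht hsq h2Δ i κT hκT κK hκK κi hκi n
  have hj := classNumberPExp_divisionField_two_eq_resolvent_add_two_mul_cubic W ht hsq h2Δ j κT hκT κK hκK κj hκj n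
  omega

end Summit.BirchSwinnertonDyer.BirchSwinnertonDyer.Theorems.AlignedTransportAtTwoSexticKurodaExact
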